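import Literature.Analysis.PDE.PatchLowerOrder
import Literature.Analysis.PDE.PatchResidualIdentity
import Literature.Analysis.PDE.SobolevLeibnizCLM
import Literature.Analysis.PDE.SobolevSupBound
import HarnessLib

/-!
# The energy of the heat residual of a cut-off chart expression: top order with the sharp
# constant, lower order through all patches (topic `Analysis/PDE`)

Analytic–geometric layer of the programme to prove short-time existence for quasilinear
strictly parabolic systems on a closed manifold (hypothesis `hQL` of
`Literature.Geometry.Riemannian.ricciFlow_shortTime_existence_of_quasilinear`). At a fixed
time, in a patch `p` of a patch system `P`, a chart expression `u = f ∘ κ_p⁻¹` satisfies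
`uₜ = frameOp (S y) 𝔟 𝔠 u + g∘κ_p⁻¹` on the target; for the cut-off expression
`w_p = cutExpr P p f` the localisation identity (`PatchResidualIdentity.lean`) splits the heat
residual `cut • uₜ - Δ w_p` into the top-order term `Σₖₗ aₖₗ • ∂ₖ∂ₗ w_p`
(`aₖₗ = cutPlus · ⟪bₖ, (S - 1) bₗ⟫`, `|aₖₗ| ≤ η`) and lower-order terms. This file proves the
ENERGY form of that splitting (`sobolevEnergy_residual_le`):

  `E_i(cut • uₜ - Δw_p) ≤ (1+ε) n² Σₖₗ [(1+ε) η² E_i(∂ₖ∂ₗw_p) + C_sh M² E_i(∂ₗw_p)]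
     + (1+ε⁻¹) [C_low (M² + 1) Σ_q (E_i(w_q) + Σ_m E_i(∂_m w_q)) + C_g E_i(cutExpr P p g)]`,

with `C_sh` the constant of the sharp Leibniz rule (depending on `i`, `ε` only), and `C_low`,
`C_g` depending on the patch system, `p` and `i` only — in particular NOT on `f`, `g`, `uₜ` or
the coefficients, which enter only through the sup bound `η` of the top coefficient and the
bound `M` of the word derivatives of the (cut-off) coefficient fields. The top term keeps the
level-independent small factor `η²`; all other terms are of order `≤ 1` in `f` and are bounded
through the cut-off expressions of ALL patches (`PatchLowerOrder.lean`).

Everything is proved; no named fact and no `sorry` is introduced.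

## References

* L. C. Evans, *Partial Differential Equations*, 2nd ed., AMS 2010, §7.1.3 (energy estimates:
  top order absorbed, lower order estimated). [Evans2010]
-/

noncomputable section

open Set Function Filter Topology Metric MeasureTheory InnerProductSpace
open scoped Manifold ContDiff Topology ENNReal RealInnerProductSpace Laplacian

namespace Literature.Analysis.PDE

open Literature.Geometry.Manifold Literature.Analysis.FunctionSpaces

variable {E : Type*} [NormedAddCommGroup E] [NormedSpace ℝ E] {H : Type*} [TopologicalSpace H]
variable {I : ModelWithCorners ℝ E H} {M : Type*} [TopologicalSpace M] [ChartedSpace H M]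
variable {E' : Type*} [NormedAddCommGroup E'] [InnerProductSpace ℝ E'] [FiniteDimensional ℝ E']
variable {F' : Type*} [NormedAddCommGroup F'] [InnerProductSpace ℝ F']
variable {ι : Type*} [Fintype ι] (P : PatchSystem I M E' ι)

namespace PatchSystemLoc

/-! ### The cut-off coefficient fields of a patch -/

/-- **The top coefficient** `aₖₗ(y) = cutPlus_p(y) · ⟪bₖ, (S y - 1) bₗ⟫`. [cite: Evans2010, §7.1.3] -/
def topCoeff (p : ι) (Ss : E' → (E' →L[ℝ] E')) (k l : Fin (Module.finrank ℝ E')) (y : E') : ℝ :=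
  P.cutPlus p y * ⟪stdOrthonormalBasis ℝ E' k, (Ss y - 1) (stdOrthonormalBasis ℝ E' l)⟫

/-- **The cut-off first-order coefficient along a frame direction**:
`B_l(y) w = cutPlus_p(y) • 𝔟(y) (⟪bₗ, ·⟫ w)`. [cite: Evans2010, §7.1.3] -/
def firstCoeff (p : ι) (𝔟s : E' → ((E' →L[ℝ] F') →L[ℝ] F')) (l : Fin (Module.finrank ℝ E')) (y : E') :
    F' →L[ℝ] F' :=
  P.cutPlus p y • ((𝔟s y).comp
    (ContinuousLinearMap.smulRightL ℝ E' F' (innerSL ℝ (stdOrthonormalBasis ℝ E' l))))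

/-- **The cut-off zeroth-order coefficient** `C(y) = cutPlus_p(y) • 𝔠(y)`. [cite: Evans2010, §7.1.3] -/
def zeroCoeff (p : ι) (𝔠s : E' → (F' →L[ℝ] F')) (y : E') : F' →L[ℝ] F' := P.cutPlus p y • 𝔠s y

/-- `topCoeff_apply`: unfolding. [folklore] -/
theorem topCoeff_apply (p : ι) (Ss : E' → (E' →L[ℝ] E')) (k l : Fin (Module.finrank ℝ E')) (y : E') :
    topCoeff P p Ss k l y =
      P.cutPlus p y * ⟪stdOrthonormalBasis ℝ E' k, (Ss y - 1) (stdOrthonormalBasis ℝ E' l)⟫ := rfl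

/-- `firstCoeff_apply`: `B_l(y) w = cutPlus(y) • 𝔟(y)(⟪bₗ,·⟫ w)`. [folklore] -/
theorem firstCoeff_apply (p : ι) (𝔟s : E' → ((E' →L[ℝ] F') →L[ℝ] F')) (l : Fin (Module.finrank ℝ E'))
    (y : E') (w : F') :
    firstCoeff P p 𝔟s l y w =
      P.cutPlus p y • 𝔟s y ((innerSL ℝ (stdOrthonormalBasis ℝ E' l)).smulRight w) := by
  simp [firstCoeff, ContinuousLinearMap.smulRightL_apply_apply]

/-- `zeroCoeff_apply`: unfolding. [folklore] -/
theorem zeroCoeff_apply (p : ι) (𝔠s : E' → (F' →L[ℝ] F')) (y : E') (w : F') :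
    zeroCoeff P p 𝔠s y w = P.cutPlus p y • 𝔠s y w := rfl

/-! ### Algebraic helpers -/

/-- A continuous linear map from the model expands along the frame:
`L = Σₗ ⟪bₗ, ·⟫ • L bₗ`. [folklore] -/
theorem clm_eq_sum_smulRight (L : E' →L[ℝ] F') :
    L = ∑ l, (innerSL ℝ (stdOrthonormalBasis ℝ E' l)).smulRight (L (stdOrthonormalBasis ℝ E' l)) := by
  ext ζ
  simp only [FunLike.coe_sum, Finset.sum_apply, ContinuousLinearMap.smulRight_apply, innerSL_apply_apply]
  exact clm_apply_eq_sum_inner_smul L ζ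

/-- `cutPlus = 1` on the support of the cut-off: inserting `cutPlus` in front of a quantity that
vanishes off `tsupport cut`. [folklore] -/
theorem cutPlus_mul_eq_of_eq_zero (p : ι) {X : ℝ} {y : E'} (hX : y ∉ tsupport (P.cut p) → X = 0) :
    P.cutPlus p y * X = X := by
  by_cases hy : y ∈ tsupport (P.cut p)
  · rw [P.cutPlus_eq_one_of_mem_tsupport_cut p hy, one_mul]
  · rw [hX hy, mul_zero]

/-- Same for a vector-valued quantity. [folklore] -/
theorem cutPlus_smul_eq_of_eq_zero (p : ι) {X : F'} {y : E'} (hX : y ∉ tsupport (P.cut p) → X = 0) :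
    P.cutPlus p y • X = X := by
  by_cases hy : y ∈ tsupport (P.cut p)
  · rw [P.cutPlus_eq_one_of_mem_tsupport_cut p hy, one_smul]
  · rw [hX hy, smul_zero]

/-- The first derivative of the cut-off vanishes off its support. [folklore] -/
theorem fderiv_cut_eq_zero (p : ι) {y : E'} (hy : y ∉ tsupport (P.cut p)) : fderiv ℝ (P.cut p) y = 0 :=
  fderiv_of_notMem_tsupport ℝ hy

/-- The second frame derivatives of the cut-off vanish off its support. [folklore] -/
theorem fderiv_fderiv_cut_eq_zero (p : ι) {y : E'} (hy : y ∉ tsupport (P.cut p)) (v : E') :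
    fderiv ℝ (fun z ↦ fderiv ℝ (P.cut p) z v) y = 0 :=
  fderiv_of_notMem_tsupport ℝ fun h ↦ hy (tsupport_fderiv_apply_subset ℝ v h)

/-- The Laplacian of the cut-off vanishes off its support. [folklore] -/
theorem laplacian_cut_eq_zero (p : ι) {y : E'} (hy : y ∉ tsupport (P.cut p)) : (Δ (⇑(P.cut p))) y = 0 := by
  have hev : (P.cut p : E' → ℝ) =ᶠ[𝓝 y] fun _ ↦ 0 := notMem_tsupport_iff_eventuallyEq.1 hy
  rw [laplacian_eq_iteratedFDeriv_stdOrthonormalBasis]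
  simp [(hev.iteratedFDeriv ℝ 2).self_of_nhds, iteratedFDeriv_const_of_ne two_ne_zero]

/-- The second frame derivatives of the cut-off expression vanish off `tsupport cut`
(the expression is supported in `closedBall 0 (3rₚ) = tsupport cut`). [folklore] -/
theorem fderiv_fderiv_cutExpr_eq_zero (p : ι) (f : M → F') {y : E'} (hy : y ∉ tsupport (P.cut p))
    (v v' : E') : fderiv ℝ (fun z ↦ fderiv ℝ (cutExpr P p f) z v') y v = 0 := by
  have hts : tsupport (cutExpr P p f) ⊆ tsupport (P.cut p) := by
    rw [cutExpr_eq_smul]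
    exact tsupport_smul_subset_left _ _
  have h : fderiv ℝ (fun z ↦ fderiv ℝ (cutExpr P p f) z v') y = 0 :=
    fderiv_of_notMem_tsupport ℝ fun h ↦ hy (hts (tsupport_fderiv_apply_subset ℝ v' h))
  rw [h]
  rfl

/-- **The top term with the cut-off coefficient**:
`principalPart (S y - 1) w_p y = Σₖₗ aₖₗ(y) • ∂ₖ∂ₗw_p(y)` everywhere. [cite: Evans2010, §7.1.3] -/
theorem principalPart_sub_one_eq_sum_topCoeff (p : ι) (Ss : E' → (E' →L[ℝ] E')) (f : M → F') (y : E') :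
    principalPart (Ss y - 1) (cutExpr P p f) y =
      ∑ k, ∑ l, topCoeff P p Ss k l y • fderiv ℝ (fun z ↦ fderiv ℝ (cutExpr P p f) z
        (stdOrthonormalBasis ℝ E' l)) y (stdOrthonormalBasis ℝ E' k) := by
  rw [principalPart_apply]
  refine Finset.sum_congr rfl fun k _ ↦ Finset.sum_congr rfl fun l _ ↦ ?_
  rw [topCoeff_apply]
  by_cases hy : y ∈ tsupport (P.cut p)
  · rw [P.cutPlus_eq_one_of_mem_tsupport_cut p hy, one_mul]
  · rw [fderiv_fderiv_cutExpr_eq_zero P p f hy]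
    simp

/-! ### The lower-order terms: pointwise splitting -/

section Split

/-- **Pointwise splitting of the lower-order part of the residual** into eight products
(raw coefficients): with `m k l = ⟪bₖ, (S y - 1) bₗ⟫`,
`LOW y = -Σₖₗ m•(∂ₖcut•∂ₗu) - Σₖₗ m•(∂ₗcut•∂ₖu) - (Σₖₗ m ∂ₖ∂ₗcut)•u + cut•𝔟(Du) + cut•𝔠u
  + cutExpr g - 2Σₗ ∂ₗcut•∂ₗu - Δcut•u`. [cite: Evans2010, §7.1.3] -/
theorem low_split (p : ι) (Ss : E' → (E' →L[ℝ] E')) (𝔟s : E' → ((E' →L[ℝ] F') →L[ℝ] F'))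
    (𝔠s : E' → (F' →L[ℝ] F')) (u : E' → F') (g : M → F') (y : E') :
    -lowerSymbol (Ss y - 1) (P.cut p) u y +
        P.cut p y • (𝔟s y (fderiv ℝ u y) + 𝔠s y (u y) + g ((P.chart p).inv y)) -
        (2 • ∑ l, fderiv ℝ (P.cut p) y (stdOrthonormalBasis ℝ E' l) •
          fderiv ℝ u y (stdOrthonormalBasis ℝ E' l)) -
        (Δ (⇑(P.cut p))) y • u y =
      (-∑ k, ∑ l, ⟪stdOrthonormalBasis ℝ E' k, (Ss y - 1) (stdOrthonormalBasis ℝ E' l)⟫ •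
          (fderiv ℝ (P.cut p) y (stdOrthonormalBasis ℝ E' k) • fderiv ℝ u y (stdOrthonormalBasis ℝ E' l))) +
      ((-∑ k, ∑ l, ⟪stdOrthonormalBasis ℝ E' k, (Ss y - 1) (stdOrthonormalBasis ℝ E' l)⟫ •
          (fderiv ℝ (P.cut p) y (stdOrthonormalBasis ℝ E' l) • fderiv ℝ u y (stdOrthonormalBasis ℝ E' k))) +
      ((-∑ k, ∑ l, ⟪stdOrthonormalBasis ℝ E' k, (Ss y - 1) (stdOrthonormalBasis ℝ E' l)⟫ •
          (fderiv ℝ (fun z ↦ fderiv ℝ (P.cut p) z (stdOrthonormalBasis ℝ E' l)) y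
            (stdOrthonormalBasis ℝ E' k) • u y)) +
      (P.cut p y • 𝔟s y (fderiv ℝ u y) +
      (P.cut p y • 𝔠s y (u y) +
      (cutExpr P p g y +
      (-((2 : ℝ) • ∑ l, fderiv ℝ (P.cut p) y (stdOrthonormalBasis ℝ E' l) •
          fderiv ℝ u y (stdOrthonormalBasis ℝ E' l)) +
      -((Δ (⇑(P.cut p))) y • u y))))))) := by
  rw [lowerSymbol_apply, cutExpr_eq_smul, two_smul, two_smul]
  simp only [smul_add, Finset.sum_add_distrib, Finset.sum_smul, smul_smul, neg_add_rev]
  abel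

end Split

/-! ### Energies of the lower-order products -/

section LowEnergy

variable [MeasurableSpace E'] [BorelSpace E']

/-- **Double frame sums of scalar products**: `E_i(Σₖₗ aₖₗ • Wₖₗ) ≤ n² C_cr Mc² Σₖₗ E_i(Wₖₗ)` for
coefficients bounded by `Mc` with all their word derivatives up to order `i` (crude Leibniz).
[cite: Evans2010, §7.1.3] -/
theorem sobolevEnergy_sum_sum_smul_le (i : ℕ) :
    ∃ C : ℝ≥0∞, C ≠ ⊤ ∧ ∀ {a : Fin (Module.finrank ℝ E') → Fin (Module.finrank ℝ E') → E' → ℝ}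
      {W : Fin (Module.finrank ℝ E') → Fin (Module.finrank ℝ E') → E' → F'} {Mc : ℝ},
      (∀ k l, ContDiff ℝ ∞ (a k l)) → (∀ k l, ContDiff ℝ ∞ (W k l)) → (∀ k l y, |a k l y| ≤ Mc) →
      (∀ k l, ∀ lst : List (Fin (Module.finrank ℝ E')), lst ≠ [] → lst.length ≤ i →
        ∀ y, ‖iterDirDeriv (lst.map (stdOrthonormalBasis ℝ E')) (a k l) y‖ ≤ Mc) →
      sobolevEnergy i (fun y ↦ ∑ k, ∑ l, a k l y • W k l y) ≤
        C * ENNReal.ofReal (Mc ^ 2) * ∑ k, ∑ l, sobolevEnergy i (W k l) := by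
  classical
  obtain ⟨Ccr, hCcrtop, hCcr⟩ := sobolevEnergy_smul_le_crude (E := E') (F := F') i
  set n := Module.finrank ℝ E'
  refine ⟨((n * n : ℕ) : ℝ≥0∞) * Ccr, ENNReal.mul_ne_top (ENNReal.natCast_ne_top _) hCcrtop, ?_⟩
  intro a W Mc ha hW ha0 haw
  have heq : (fun y ↦ ∑ k, ∑ l, a k l y • W k l y) =
      fun y ↦ ∑ kl : Fin n × Fin n, a kl.1 kl.2 y • W kl.1 kl.2 y := by
    funext y; rw [Fintype.sum_prod_type]
  rw [heq]
  have hsm : ∀ kl : Fin n × Fin n, ContDiff ℝ i fun y ↦ a kl.1 kl.2 y • W kl.1 kl.2 y := fun kl ↦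
    ((ha kl.1 kl.2).smul (hW kl.1 kl.2)).of_le (by exact_mod_cast le_top)
  calc sobolevEnergy i (fun y ↦ ∑ kl : Fin n × Fin n, a kl.1 kl.2 y • W kl.1 kl.2 y)
      ≤ (Finset.univ.card : ℝ≥0∞) * ∑ kl : Fin n × Fin n,
          sobolevEnergy i (fun y ↦ a kl.1 kl.2 y • W kl.1 kl.2 y) :=
        sobolevEnergy_sum_le_card i Finset.univ fun kl _ ↦ hsm kl
    _ ≤ ((n * n : ℕ) : ℝ≥0∞) * ∑ kl : Fin n × Fin n, Ccr * ENNReal.ofReal (Mc ^ 2) *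
          sobolevEnergy i (W kl.1 kl.2) := by
        refine mul_le_mul' (le_of_eq ?_) (Finset.sum_le_sum fun kl _ ↦ ?_)
        · rw [Finset.card_univ, Fintype.card_prod, Fintype.card_fin]
        · exact hCcr (ha kl.1 kl.2) (hW kl.1 kl.2) (ha0 kl.1 kl.2) (haw kl.1 kl.2)
    _ = ((n * n : ℕ) : ℝ≥0∞) * Ccr * ENNReal.ofReal (Mc ^ 2) * ∑ k, ∑ l, sobolevEnergy i (W k l) := by
        rw [← Finset.mul_sum, Fintype.sum_prod_type]
        ring

omit [MeasurableSpace E'] [BorelSpace E'] in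
/-- Inserting `cutPlus` in front of products carrying a factor supported in `tsupport cut`:
`Σₖₗ ⟪bₖ,(S-1)bₗ⟫ • (sₖₗ • Zₖₗ) = Σₖₗ aₖₗ • (sₖₗ • Zₖₗ)` when `sₖₗ = 0` off `tsupport cut`.
[folklore] -/
theorem sum_sum_inner_smul_eq_topCoeff (p : ι) (Ss : E' → (E' →L[ℝ] E'))
    {s : Fin (Module.finrank ℝ E') → Fin (Module.finrank ℝ E') → E' → ℝ}
    (hs : ∀ k l y, y ∉ tsupport (P.cut p) → s k l y = 0)
    (Z : Fin (Module.finrank ℝ E') → Fin (Module.finrank ℝ E') → E' → F') (y : E') :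
    ∑ k, ∑ l, ⟪stdOrthonormalBasis ℝ E' k, (Ss y - 1) (stdOrthonormalBasis ℝ E' l)⟫ • (s k l y • Z k l y) =
      ∑ k, ∑ l, topCoeff P p Ss k l y • (s k l y • Z k l y) := by
  refine Finset.sum_congr rfl fun k _ ↦ Finset.sum_congr rfl fun l _ ↦ ?_
  rw [topCoeff_apply, smul_smul, smul_smul, mul_comm (P.cutPlus p y), mul_assoc,
    cutPlus_mul_eq_of_eq_zero P p (hs k l y)]

omit [MeasurableSpace E'] [BorelSpace E'] in
/-- The first-order coefficient term through the cut-off coefficients: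
`cut • 𝔟(Du) = Σₗ B_l (cut • ∂ₗu)`. [folklore] -/
theorem cut_smul_first_eq_sum_firstCoeff (p : ι) (𝔟s : E' → ((E' →L[ℝ] F') →L[ℝ] F')) (u : E' → F')
    (y : E') :
    P.cut p y • 𝔟s y (fderiv ℝ u y) =
      ∑ l, firstCoeff P p 𝔟s l y (P.cut p y • fderiv ℝ u y (stdOrthonormalBasis ℝ E' l)) := by
  set b := stdOrthonormalBasis ℝ E'
  have h1 : P.cut p y • 𝔟s y (fderiv ℝ u y) = 𝔟s y (P.cut p y • fderiv ℝ u y) := by rw [map_smul]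
  rw [h1]
  conv_lhs => rw [clm_eq_sum_smulRight (P.cut p y • fderiv ℝ u y), map_sum]
  refine Finset.sum_congr rfl fun l _ ↦ ?_
  rw [firstCoeff_apply, smul_apply]
  refine (cutPlus_smul_eq_of_eq_zero P p fun hy ↦ ?_).symm
  rw [image_eq_zero_of_notMem_tsupport hy, zero_smul]
  have h0 : ((innerSL ℝ) (b l)).smulRight (0 : F') = 0 := by ext; simp
  rw [h0, map_zero]

omit [MeasurableSpace E'] [BorelSpace E'] in
/-- The zeroth-order coefficient term through the cut-off coefficient:
`cut • 𝔠 u = C (cut • u)`. [folklore] -/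
theorem cut_smul_zero_eq_zeroCoeff (p : ι) (𝔠s : E' → (F' →L[ℝ] F')) (u : E' → F') (y : E') :
    P.cut p y • 𝔠s y (u y) = zeroCoeff P p 𝔠s y (P.cut p y • u y) := by
  rw [zeroCoeff_apply, map_smul]
  refine (cutPlus_smul_eq_of_eq_zero P p fun hy ↦ ?_).symm
  rw [image_eq_zero_of_notMem_tsupport hy, zero_smul]

/-- Energies are invariant under negation of the function (smooth case). [folklore] -/
theorem sobolevEnergy_neg' (i : ℕ) {T : E' → F'} (hT : ContDiff ℝ ∞ T) :
    sobolevEnergy i (fun y ↦ -T y) = sobolevEnergy i T :=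
  sobolevEnergy_neg i (hT.of_le (by exact_mod_cast le_top))

variable [IsManifold I ∞ M] [I.Boundaryless] [T2Space M]

/-- **The lower-order part of the residual, bounded through all patches**: for every `i` there
are `C_low, C_g < ∞` (depending on the patch system, `p`, `i` only) such that for all data —
`f` with smooth chart expressions, `g`, coefficient slices whose cut-off coefficient fields are
smooth and bounded by `Mc` together with their word derivatives up to order `i` —
`E_i(LOW) ≤ C_low (Mc² + 1) Σ_q (E_i(w_q) + Σ_m E_i(∂_m w_q)) + C_g E_i(cutExpr P p g)` with
`LOW = -lowerSymbol (S-1) cut u + cut • (𝔟(Du) + 𝔠u + g∘κ_p⁻¹) - 2Σₗ ∂ₗcut • ∂ₗu - Δcut • u`,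
`u = f ∘ κ_p⁻¹`. [cite: Evans2010, §7.1.3] -/
theorem sobolevEnergy_low_le (p : ι) (i : ℕ) :
    ∃ Clow Cg : ℝ≥0∞, Clow ≠ ⊤ ∧ Cg ≠ ⊤ ∧
      ∀ {f g : M → F'} {Ss : E' → (E' →L[ℝ] E')} {𝔟s : E' → ((E' →L[ℝ] F') →L[ℝ] F')}
        {𝔠s : E' → (F' →L[ℝ] F')} {Mc : ℝ},
      (∀ q, ContDiffOn ℝ ∞ (f ∘ (P.chart q).inv) (P.chart q).target) →
      ContDiffOn ℝ ∞ (g ∘ (P.chart p).inv) (P.chart p).target →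
      (∀ k l, ContDiff ℝ ∞ (topCoeff P p Ss k l)) → (∀ l, ContDiff ℝ ∞ (firstCoeff P p 𝔟s l)) →
      ContDiff ℝ ∞ (zeroCoeff P p 𝔠s) →
      (∀ k l y, |topCoeff P p Ss k l y| ≤ Mc) →
      (∀ k l, ∀ lst : List (Fin (Module.finrank ℝ E')), lst ≠ [] → lst.length ≤ i →
        ∀ y, ‖iterDirDeriv (lst.map (stdOrthonormalBasis ℝ E')) (topCoeff P p Ss k l) y‖ ≤ Mc) →
      (∀ l y, ‖firstCoeff P p 𝔟s l y‖ ≤ Mc) →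
      (∀ l, ∀ lst : List (Fin (Module.finrank ℝ E')), lst ≠ [] → lst.length ≤ i →
        ∀ y, ‖iterDirDeriv (lst.map (stdOrthonormalBasis ℝ E')) (firstCoeff P p 𝔟s l) y‖ ≤ Mc) →
      (∀ y, ‖zeroCoeff P p 𝔠s y‖ ≤ Mc) →
      (∀ lst : List (Fin (Module.finrank ℝ E')), lst ≠ [] → lst.length ≤ i →
        ∀ y, ‖iterDirDeriv (lst.map (stdOrthonormalBasis ℝ E')) (zeroCoeff P p 𝔠s) y‖ ≤ Mc) →
      sobolevEnergy i (fun y ↦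
          -lowerSymbol (Ss y - 1) (P.cut p) (f ∘ (P.chart p).inv) y +
          P.cut p y • (𝔟s y (fderiv ℝ (f ∘ (P.chart p).inv) y) + 𝔠s y ((f ∘ (P.chart p).inv) y) +
            g ((P.chart p).inv y)) -
          (2 • ∑ l, fderiv ℝ (P.cut p) y (stdOrthonormalBasis ℝ E' l) •
            fderiv ℝ (f ∘ (P.chart p).inv) y (stdOrthonormalBasis ℝ E' l)) -
          (Δ (⇑(P.cut p))) y • (f ∘ (P.chart p).inv) y) ≤
        Clow * ENNReal.ofReal (Mc ^ 2 + 1) *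
            ∑ q, (sobolevEnergy i (cutExpr P q f) +
              ∑ m, sobolevEnergy i (fun y ↦ fderiv ℝ (cutExpr P q f) y (stdOrthonormalBasis ℝ E' m))) +
          Cg * sobolevEnergy i (cutExpr P p g) := by
  classical
  set b := stdOrthonormalBasis ℝ E'
  -- the cut-off, its derived multipliers and their common compact support
  have hcs : ContDiff ℝ ∞ (P.cut p) := (P.cut p).contDiff
  have hct : tsupport (P.cut p) ⊆ (P.chart p).target := P.tsupport_cut_subset p
  have hCθ : IsCompact (tsupport (P.cut p)) := by
    rw [ContDiffBump.tsupport_eq]; exact isCompact_closedBall _ _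
  have hθ₁s : ∀ k, ContDiff ℝ ∞ fun y ↦ fderiv ℝ (P.cut p) y (b k) := fun k ↦
    contDiff_fderiv_apply_of_contDiff hcs (b k)
  have hθ₁t : ∀ k, tsupport (fun y ↦ fderiv ℝ (P.cut p) y (b k)) ⊆ tsupport (P.cut p) := fun k ↦
    tsupport_fderiv_apply_subset ℝ (b k)
  have hθ₂s : ∀ k l, ContDiff ℝ ∞ fun y ↦ fderiv ℝ (fun z ↦ fderiv ℝ (P.cut p) z (b l)) y (b k) := fun k l ↦
    contDiff_fderiv_apply_of_contDiff (hθ₁s l) (b k)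
  have hθ₂t : ∀ k l, tsupport (fun y ↦ fderiv ℝ (fun z ↦ fderiv ℝ (P.cut p) z (b l)) y (b k)) ⊆
      tsupport (P.cut p) := fun k l ↦ (tsupport_fderiv_apply_subset ℝ (b k)).trans (hθ₁t l)
  have hθ₃s : ContDiff ℝ ∞ (Δ (⇑(P.cut p))) := contDiff_laplacian_of_contDiff hcs
  have hθ₃t : tsupport (Δ (⇑(P.cut p))) ⊆ tsupport (P.cut p) := by
    refine closure_minimal (fun y hy ↦ ?_) (isClosed_tsupport _)
    by_contra h
    exact hy (laplacian_cut_eq_zero P p h)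
  -- transport constants from `PatchLowerOrder`
  obtain ⟨C₀, hC₀top, hC₀⟩ := sobolevEnergy_smul_comp_inv_le (F := F') P p hcs hCθ hct Subset.rfl i
  have h1 : ∀ k l, ∃ C : ℝ≥0∞, C ≠ ⊤ ∧ ∀ {f : M → F'},
      (∀ q, ContDiffOn ℝ ∞ (f ∘ (P.chart q).inv) (P.chart q).target) →
      sobolevEnergy i (fun y ↦ fderiv ℝ (P.cut p) y (b k) • fderiv ℝ (f ∘ (P.chart p).inv) y (b l)) ≤
        C * ∑ q, (sobolevEnergy i (cutExpr P q f) +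
          ∑ m, sobolevEnergy i (fun y ↦ fderiv ℝ (cutExpr P q f) y (b m))) :=
    fun k l ↦ sobolevEnergy_smul_fderiv_comp_inv_le (F := F') P p (hθ₁s k) hCθ hct (hθ₁t k) (b l) i
  choose C₁ hC₁top hC₁ using h1
  have h1' : ∀ l, ∃ C : ℝ≥0∞, C ≠ ⊤ ∧ ∀ {f : M → F'},
      (∀ q, ContDiffOn ℝ ∞ (f ∘ (P.chart q).inv) (P.chart q).target) →
      sobolevEnergy i (fun y ↦ P.cut p y • fderiv ℝ (f ∘ (P.chart p).inv) y (b l)) ≤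
        C * ∑ q, (sobolevEnergy i (cutExpr P q f) +
          ∑ m, sobolevEnergy i (fun y ↦ fderiv ℝ (cutExpr P q f) y (b m))) :=
    fun l ↦ sobolevEnergy_smul_fderiv_comp_inv_le (F := F') P p hcs hCθ hct Subset.rfl (b l) i
  choose C₁' hC₁'top hC₁' using h1'
  have h2 : ∀ k l, ∃ C : ℝ≥0∞, C ≠ ⊤ ∧ ∀ {f : M → F'},
      (∀ q, ContDiffOn ℝ ∞ (f ∘ (P.chart q).inv) (P.chart q).target) →
      sobolevEnergy i (fun y ↦ fderiv ℝ (fun z ↦ fderiv ℝ (P.cut p) z (b l)) y (b k) •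
          f ((P.chart p).inv y)) ≤ C * ∑ q, sobolevEnergy i (cutExpr P q f) :=
    fun k l ↦ sobolevEnergy_smul_comp_inv_le (F := F') P p (hθ₂s k l) hCθ hct (hθ₂t k l) i
  choose C₂ hC₂top hC₂ using h2
  obtain ⟨C₃, hC₃top, hC₃⟩ := sobolevEnergy_smul_comp_inv_le (F := F') P p hθ₃s hCθ hct hθ₃t i
  -- Leibniz constants
  obtain ⟨Cdd, hCddtop, hCdd⟩ := sobolevEnergy_sum_sum_smul_le (F' := F') (E' := E') i
  obtain ⟨Ccl, hCcltop, hCcl⟩ := sobolevEnergy_clm_apply_le_crude (E := E') (F := F') (G := F') i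
  -- total constants
  set S₁ : ℝ≥0∞ := ∑ k, ∑ l, C₁ k l with hS₁
  set S₁' : ℝ≥0∞ := ∑ l, C₁' l with hS₁'
  set S₂ : ℝ≥0∞ := ∑ k, ∑ l, C₂ k l with hS₂
  set A : ℝ≥0∞ := Cdd * (S₁ + S₁ + S₂) + (Module.finrank ℝ E' : ℝ≥0∞) * Ccl * S₁' + Ccl * C₀ with hA
  set B : ℝ≥0∞ := 4 * (Module.finrank ℝ E' : ℝ≥0∞) * S₁ + C₃ with hB
  have hS₁top : S₁ ≠ ⊤ := ENNReal.sum_ne_top.2 fun k _ ↦ ENNReal.sum_ne_top.2 fun l _ ↦ hC₁top k l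
  have hS₁'top : S₁' ≠ ⊤ := ENNReal.sum_ne_top.2 fun l _ ↦ hC₁'top l
  have hS₂top : S₂ ≠ ⊤ := ENNReal.sum_ne_top.2 fun k _ ↦ ENNReal.sum_ne_top.2 fun l _ ↦ hC₂top k l
  have hntop : (Module.finrank ℝ E' : ℝ≥0∞) ≠ ⊤ := ENNReal.natCast_ne_top _
  have hAtop : A ≠ ⊤ := by
    rw [hA]
    exact ENNReal.add_ne_top.2 ⟨ENNReal.add_ne_top.2 ⟨ENNReal.mul_ne_top hCddtop
      (ENNReal.add_ne_top.2 ⟨ENNReal.add_ne_top.2 ⟨hS₁top, hS₁top⟩, hS₂top⟩),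
      ENNReal.mul_ne_top (ENNReal.mul_ne_top hntop hCcltop) hS₁'top⟩, ENNReal.mul_ne_top hCcltop hC₀top⟩
  have hBtop : B ≠ ⊤ := by
    rw [hB]
    exact ENNReal.add_ne_top.2 ⟨ENNReal.mul_ne_top (ENNReal.mul_ne_top (by norm_num) hntop) hS₁top, hC₃top⟩
  refine ⟨8 * (A + B), 8, ENNReal.mul_ne_top (by norm_num) (ENNReal.add_ne_top.2 ⟨hAtop, hBtop⟩),
    by norm_num, ?_⟩
  intro f g Ss 𝔟s 𝔠s Mc hf hg ha hBf hCf ha0 haw hB0 hBw hC0 hCw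
  -- abbreviations
  set u : E' → F' := f ∘ (P.chart p).inv with hu
  have huV : ContDiffOn ℝ ∞ u (P.chart p).target := hf p
  have huV' : ∀ l, ContDiffOn ℝ ∞ (fun y ↦ fderiv ℝ u y (b l)) (P.chart p).target := fun l ↦
    contDiffOn_fderiv_apply_of_isOpen (P.chart p).isOpen_target huV (b l)
  set TOT : ℝ≥0∞ := ∑ q, (sobolevEnergy i (cutExpr P q f) +
    ∑ m, sobolevEnergy i (fun y ↦ fderiv ℝ (cutExpr P q f) y (b m))) with hTOT
  have hTOT0 : ∑ q, sobolevEnergy i (cutExpr P q f) ≤ TOT := Finset.sum_le_sum fun q _ ↦ le_self_add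
  have hV := (P.chart p).isOpen_target
  -- the globally smooth building blocks
  have hW₁ : ∀ k l, ContDiff ℝ ∞ fun y ↦ fderiv ℝ (P.cut p) y (b k) • fderiv ℝ u y (b l) := fun k l ↦
    contDiff_smul_of_tsupport_subset hV (hθ₁s k) ((hθ₁t k).trans hct) (huV' l)
  have hW₃ : ∀ k l, ContDiff ℝ ∞ fun y ↦
      fderiv ℝ (fun z ↦ fderiv ℝ (P.cut p) z (b l)) y (b k) • u y := fun k l ↦
    contDiff_smul_of_tsupport_subset hV (hθ₂s k l) ((hθ₂t k l).trans hct) huV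
  have hW₄ : ∀ l, ContDiff ℝ ∞ fun y ↦ P.cut p y • fderiv ℝ u y (b l) := fun l ↦
    contDiff_smul_of_tsupport_subset hV hcs hct (huV' l)
  have hW₅ : ContDiff ℝ ∞ fun y ↦ P.cut p y • u y := contDiff_smul_of_tsupport_subset hV hcs hct huV
  have hW₈ : ContDiff ℝ ∞ fun y ↦ (Δ (⇑(P.cut p))) y • u y :=
    contDiff_smul_of_tsupport_subset hV hθ₃s (hθ₃t.trans hct) huV
  have hw : ∀ q, ContDiff ℝ ∞ (cutExpr P q f) := fun q ↦ contDiff_cutExpr P (hf q)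
  have hwg : ContDiff ℝ ∞ (cutExpr P p g) := contDiff_cutExpr P hg
  -- the eight terms as opaque functions
  obtain ⟨T₁, hT₁⟩ : ∃ T₁ : E' → F', T₁ = fun y ↦ ∑ k, ∑ l, topCoeff P p Ss k l y •
      (fderiv ℝ (P.cut p) y (b k) • fderiv ℝ u y (b l)) := ⟨_, rfl⟩
  obtain ⟨T₂, hT₂⟩ : ∃ T₂ : E' → F', T₂ = fun y ↦ ∑ k, ∑ l, topCoeff P p Ss k l y •
      (fderiv ℝ (P.cut p) y (b l) • fderiv ℝ u y (b k)) := ⟨_, rfl⟩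
  obtain ⟨T₃, hT₃⟩ : ∃ T₃ : E' → F', T₃ = fun y ↦ ∑ k, ∑ l, topCoeff P p Ss k l y •
      (fderiv ℝ (fun z ↦ fderiv ℝ (P.cut p) z (b l)) y (b k) • u y) := ⟨_, rfl⟩
  obtain ⟨T₄, hT₄⟩ : ∃ T₄ : E' → F', T₄ = fun y ↦ ∑ l, firstCoeff P p 𝔟s l y
      (P.cut p y • fderiv ℝ u y (b l)) := ⟨_, rfl⟩
  obtain ⟨T₅, hT₅⟩ : ∃ T₅ : E' → F', T₅ = fun y ↦ zeroCoeff P p 𝔠s y (P.cut p y • u y) := ⟨_, rfl⟩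
  obtain ⟨T₇, hT₇⟩ : ∃ T₇ : E' → F', T₇ = fun y ↦ ∑ l, fderiv ℝ (P.cut p) y (b l) • fderiv ℝ u y (b l) :=
    ⟨_, rfl⟩
  obtain ⟨T₈, hT₈⟩ : ∃ T₈ : E' → F', T₈ = fun y ↦ (Δ (⇑(P.cut p))) y • u y := ⟨_, rfl⟩
  -- smoothness of the terms
  have hT₁s : ContDiff ℝ ∞ T₁ := by
    rw [hT₁]; exact ContDiff.sum fun k _ ↦ ContDiff.sum fun l _ ↦ (ha k l).smul (hW₁ k l)
  have hT₂s : ContDiff ℝ ∞ T₂ := by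
    rw [hT₂]; exact ContDiff.sum fun k _ ↦ ContDiff.sum fun l _ ↦ (ha k l).smul (hW₁ l k)
  have hT₃s : ContDiff ℝ ∞ T₃ := by
    rw [hT₃]; exact ContDiff.sum fun k _ ↦ ContDiff.sum fun l _ ↦ (ha k l).smul (hW₃ k l)
  have hT₄s : ContDiff ℝ ∞ T₄ := by
    rw [hT₄]; exact ContDiff.sum fun l _ ↦ (hBf l).clm_apply (hW₄ l)
  have hT₅s : ContDiff ℝ ∞ T₅ := by rw [hT₅]; exact hCf.clm_apply hW₅
  have hT₇s : ContDiff ℝ ∞ T₇ := by rw [hT₇]; exact ContDiff.sum fun l _ ↦ hW₁ l l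
  have hT₈s : ContDiff ℝ ∞ T₈ := by rw [hT₈]; exact hW₈
  -- Step 1: the function is `-T₁ - T₂ - T₃ + T₄ + T₅ + T₆ - 2T₇ - T₈`, written as a sum over `Fin 8`
  set TT : Fin 8 → E' → F' := ![fun y ↦ -T₁ y, fun y ↦ -T₂ y, fun y ↦ -T₃ y, T₄, T₅, cutExpr P p g,
    fun y ↦ (-2 : ℝ) • T₇ y, fun y ↦ -T₈ y] with hTT
  have hTTs : ∀ j, ContDiff ℝ ∞ (TT j) := by
    intro j
    fin_cases j
    · exact hT₁s.neg
    · exact hT₂s.neg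
    · exact hT₃s.neg
    · exact hT₄s
    · exact hT₅s
    · exact hwg
    · exact hT₇s.const_smul _
    · exact hT₈s.neg
  have hsplit : (fun y ↦ -lowerSymbol (Ss y - 1) (P.cut p) u y +
        P.cut p y • (𝔟s y (fderiv ℝ u y) + 𝔠s y (u y) + g ((P.chart p).inv y)) -
        (2 • ∑ l, fderiv ℝ (P.cut p) y (b l) • fderiv ℝ u y (b l)) - (Δ (⇑(P.cut p))) y • u y) =
      fun y ↦ ∑ j, TT j y := by
    funext y
    rw [low_split P p Ss 𝔟s 𝔠s u g y, Fin.sum_univ_eight]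
    have e1 := sum_sum_inner_smul_eq_topCoeff (F' := F') P p Ss
      (s := fun k _ y ↦ fderiv ℝ (P.cut p) y (b k))
      (fun k l y hy ↦ by simp [fderiv_cut_eq_zero P p hy]) (fun k l y ↦ fderiv ℝ u y (b l)) y
    have e2 := sum_sum_inner_smul_eq_topCoeff (F' := F') P p Ss
      (s := fun _ l y ↦ fderiv ℝ (P.cut p) y (b l))
      (fun k l y hy ↦ by simp [fderiv_cut_eq_zero P p hy]) (fun k l y ↦ fderiv ℝ u y (b k)) y
    have e3 := sum_sum_inner_smul_eq_topCoeff (F' := F') P p Ss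
      (s := fun k l y ↦ fderiv ℝ (fun z ↦ fderiv ℝ (P.cut p) z (b l)) y (b k))
      (fun k l y hy ↦ by simp [fderiv_fderiv_cut_eq_zero P p hy]) (fun _ _ y ↦ u y) y
    have e4 := cut_smul_first_eq_sum_firstCoeff P p 𝔟s u y
    have e5 := cut_smul_zero_eq_zeroCoeff P p 𝔠s u y
    simp only [hTT, hT₁, hT₂, hT₃, hT₄, hT₅, hT₇, hT₈, Matrix.cons_val_zero, Matrix.cons_val_one,
      Matrix.head_cons, Matrix.cons_val_two, Matrix.tail_cons, Matrix.cons_val_three,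
      Matrix.cons_val_four, Matrix.cons_val]
    rw [e1, e2, e3, e4, e5]
    simp only [neg_smul]
    abel
  -- Step 2: the energy of the sum
  rw [hsplit]
  have hsum : sobolevEnergy i (fun y ↦ ∑ j, TT j y) ≤ 8 * ∑ j, sobolevEnergy i (TT j) := by
    have h := sobolevEnergy_sum_le_card i (Finset.univ : Finset (Fin 8)) (f := TT)
      fun j _ ↦ (hTTs j).of_le (by exact_mod_cast le_top)
    simpa using h
  refine hsum.trans ?_
  rw [Fin.sum_univ_eight]
  simp only [hTT, Matrix.cons_val_zero, Matrix.cons_val_one, Matrix.head_cons, Matrix.cons_val_two,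
    Matrix.tail_cons, Matrix.cons_val_three, Matrix.cons_val_four, Matrix.cons_val]
  -- Step 3: the individual bounds
  have hMc2 : ENNReal.ofReal (Mc ^ 2) ≤ ENNReal.ofReal (Mc ^ 2 + 1) := ENNReal.ofReal_le_ofReal (by linarith)
  have bT₁ : sobolevEnergy i (fun y ↦ -T₁ y) ≤ Cdd * ENNReal.ofReal (Mc ^ 2) * (S₁ * TOT) := by
    rw [sobolevEnergy_neg' i hT₁s, hT₁]
    refine (hCdd ha (fun k l ↦ hW₁ k l) ha0 haw).trans (mul_le_mul' le_rfl ?_)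
    rw [hS₁, Finset.sum_mul]
    refine Finset.sum_le_sum fun k _ ↦ ?_
    rw [Finset.sum_mul]
    exact Finset.sum_le_sum fun l _ ↦ hC₁ k l hf
  have bT₂ : sobolevEnergy i (fun y ↦ -T₂ y) ≤ Cdd * ENNReal.ofReal (Mc ^ 2) * (S₁ * TOT) := by
    rw [sobolevEnergy_neg' i hT₂s, hT₂]
    refine (hCdd ha (fun k l ↦ hW₁ l k) ha0 haw).trans (mul_le_mul' le_rfl ?_)
    rw [hS₁, Finset.sum_mul, Finset.sum_comm]
    refine Finset.sum_le_sum fun l _ ↦ ?_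
    rw [Finset.sum_mul]
    exact Finset.sum_le_sum fun k _ ↦ hC₁ l k hf
  have bT₃ : sobolevEnergy i (fun y ↦ -T₃ y) ≤ Cdd * ENNReal.ofReal (Mc ^ 2) * (S₂ * TOT) := by
    rw [sobolevEnergy_neg' i hT₃s, hT₃]
    refine (hCdd ha (fun k l ↦ hW₃ k l) ha0 haw).trans (mul_le_mul' le_rfl ?_)
    rw [hS₂, Finset.sum_mul]
    refine Finset.sum_le_sum fun k _ ↦ ?_
    rw [Finset.sum_mul]
    exact Finset.sum_le_sum fun l _ ↦ (hC₂ k l hf).trans (mul_le_mul' le_rfl hTOT0)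
  have bT₄ : sobolevEnergy i T₄ ≤ (Module.finrank ℝ E' : ℝ≥0∞) * Ccl * ENNReal.ofReal (Mc ^ 2) * (S₁' * TOT) := by
    rw [hT₄]
    have hsm : ∀ l, ContDiff ℝ i fun y ↦ firstCoeff P p 𝔟s l y (P.cut p y • fderiv ℝ u y (b l)) :=
      fun l ↦ ((hBf l).clm_apply (hW₄ l)).of_le (by exact_mod_cast le_top)
    calc sobolevEnergy i (fun y ↦ ∑ l, firstCoeff P p 𝔟s l y (P.cut p y • fderiv ℝ u y (b l)))
        ≤ (Finset.univ.card : ℝ≥0∞) * ∑ l, sobolevEnergy i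
            (fun y ↦ firstCoeff P p 𝔟s l y (P.cut p y • fderiv ℝ u y (b l))) :=
          sobolevEnergy_sum_le_card i Finset.univ fun l _ ↦ hsm l
      _ ≤ (Module.finrank ℝ E' : ℝ≥0∞) * ∑ l, Ccl * ENNReal.ofReal (Mc ^ 2) * (C₁' l * TOT) := by
          rw [Finset.card_univ, Fintype.card_fin]
          refine mul_le_mul' le_rfl (Finset.sum_le_sum fun l _ ↦ ?_)
          exact (hCcl (hBf l) (hW₄ l) (hB0 l) (hBw l)).trans (mul_le_mul' le_rfl (hC₁' l hf))
      _ = (Module.finrank ℝ E' : ℝ≥0∞) * Ccl * ENNReal.ofReal (Mc ^ 2) * (S₁' * TOT) := by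
          rw [hS₁', Finset.sum_mul, Finset.mul_sum, Finset.mul_sum]
          refine Finset.sum_congr rfl fun l _ ↦ ?_
          ring
  have bT₅ : sobolevEnergy i T₅ ≤ Ccl * ENNReal.ofReal (Mc ^ 2) * (C₀ * TOT) := by
    rw [hT₅]
    exact (hCcl hCf hW₅ hC0 hCw).trans (mul_le_mul' le_rfl ((hC₀ hf).trans (mul_le_mul' le_rfl hTOT0)))
  have bT₇ : sobolevEnergy i (fun y ↦ (-2 : ℝ) • T₇ y) ≤ 4 * ((Module.finrank ℝ E' : ℝ≥0∞) * (S₁ * TOT)) := by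
    rw [sobolevEnergy_const_smul i (hT₇s.of_le (by exact_mod_cast le_top)), hT₇]
    have h4 : ‖(-2 : ℝ)‖ₑ ^ 2 = 4 := by
      rw [← ofReal_norm, norm_neg, Real.norm_eq_abs, abs_two, ← ENNReal.ofReal_pow zero_le_two]
      norm_num
    rw [h4]
    refine mul_le_mul' le_rfl ?_
    have hsm : ∀ l, ContDiff ℝ i fun y ↦ fderiv ℝ (P.cut p) y (b l) • fderiv ℝ u y (b l) := fun l ↦
      (hW₁ l l).of_le (by exact_mod_cast le_top)
    calc sobolevEnergy i (fun y ↦ ∑ l, fderiv ℝ (P.cut p) y (b l) • fderiv ℝ u y (b l))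
        ≤ (Finset.univ.card : ℝ≥0∞) * ∑ l, sobolevEnergy i
            (fun y ↦ fderiv ℝ (P.cut p) y (b l) • fderiv ℝ u y (b l)) :=
          sobolevEnergy_sum_le_card i Finset.univ fun l _ ↦ hsm l
      _ ≤ (Module.finrank ℝ E' : ℝ≥0∞) * ∑ l, C₁ l l * TOT := by
          rw [Finset.card_univ, Fintype.card_fin]
          exact mul_le_mul' le_rfl (Finset.sum_le_sum fun l _ ↦ hC₁ l l hf)
      _ ≤ (Module.finrank ℝ E' : ℝ≥0∞) * (S₁ * TOT) := by
          refine mul_le_mul' le_rfl ?_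
          rw [hS₁, Finset.sum_mul]
          refine Finset.sum_le_sum fun l _ ↦ ?_
          rw [Finset.sum_mul]
          exact Finset.single_le_sum (f := fun k ↦ C₁ l k * TOT) (fun _ _ ↦ bot_le) (Finset.mem_univ l)
  have bT₈ : sobolevEnergy i (fun y ↦ -T₈ y) ≤ C₃ * TOT := by
    rw [sobolevEnergy_neg' i hT₈s, hT₈]
    exact (hC₃ hf).trans (mul_le_mul' le_rfl hTOT0)
  -- Step 4: assemble
  have hkey : sobolevEnergy i (fun y ↦ -T₁ y) + sobolevEnergy i (fun y ↦ -T₂ y) +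
      sobolevEnergy i (fun y ↦ -T₃ y) + sobolevEnergy i T₄ + sobolevEnergy i T₅ +
      sobolevEnergy i (cutExpr P p g) + sobolevEnergy i (fun y ↦ (-2 : ℝ) • T₇ y) +
      sobolevEnergy i (fun y ↦ -T₈ y) ≤
      (A + B) * ENNReal.ofReal (Mc ^ 2 + 1) * TOT + sobolevEnergy i (cutExpr P p g) := by
    have hM1 : ENNReal.ofReal (Mc ^ 2) ≤ ENNReal.ofReal (Mc ^ 2 + 1) := hMc2
    have h11 : (1 : ℝ≥0∞) ≤ ENNReal.ofReal (Mc ^ 2 + 1) := by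
      rw [← ENNReal.ofReal_one]; exact ENNReal.ofReal_le_ofReal (by nlinarith)
    calc _ ≤ Cdd * ENNReal.ofReal (Mc ^ 2) * (S₁ * TOT) + Cdd * ENNReal.ofReal (Mc ^ 2) * (S₁ * TOT) +
          Cdd * ENNReal.ofReal (Mc ^ 2) * (S₂ * TOT) + (Module.finrank ℝ E' : ℝ≥0∞) * Ccl * ENNReal.ofReal (Mc ^ 2) * (S₁' * TOT) +
          Ccl * ENNReal.ofReal (Mc ^ 2) * (C₀ * TOT) + sobolevEnergy i (cutExpr P p g) +
          4 * ((Module.finrank ℝ E' : ℝ≥0∞) * (S₁ * TOT)) + C₃ * TOT := by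
          gcongr
      _ = (ENNReal.ofReal (Mc ^ 2) * A + 1 * B) * TOT + sobolevEnergy i (cutExpr P p g) := by
          rw [hA, hB]; ring
      _ ≤ (ENNReal.ofReal (Mc ^ 2 + 1) * A + ENNReal.ofReal (Mc ^ 2 + 1) * B) * TOT +
          sobolevEnergy i (cutExpr P p g) := by
          gcongr
      _ = (A + B) * ENNReal.ofReal (Mc ^ 2 + 1) * TOT + sobolevEnergy i (cutExpr P p g) := by ring
  calc 8 * (sobolevEnergy i (fun y ↦ -T₁ y) + sobolevEnergy i (fun y ↦ -T₂ y) +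
        sobolevEnergy i (fun y ↦ -T₃ y) + sobolevEnergy i T₄ + sobolevEnergy i T₅ +
        sobolevEnergy i (cutExpr P p g) + sobolevEnergy i (fun y ↦ (-2 : ℝ) • T₇ y) +
        sobolevEnergy i (fun y ↦ -T₈ y))
      ≤ 8 * ((A + B) * ENNReal.ofReal (Mc ^ 2 + 1) * TOT + sobolevEnergy i (cutExpr P p g)) :=
        mul_le_mul' le_rfl hkey
    _ = 8 * (A + B) * ENNReal.ofReal (Mc ^ 2 + 1) * TOT + 8 * sobolevEnergy i (cutExpr P p g) := by ring

end LowEnergy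

/-! ### The top-order term with the sharp constant, and the residual -/

section Top

variable [MeasurableSpace E'] [BorelSpace E'] [I.Boundaryless]

/-- **The top-order term with the sharp constant**: for `ε ∈ (0, 1]` and every `i` there is
`C_sh < ∞` (the constant of the sharp Leibniz rule; depends on `i`, `ε`, the dimensions only)
such that whenever the cut-off top coefficients `aₖₗ` are smooth with `|aₖₗ| ≤ η` and word
derivatives up to order `i` bounded by `Mc`,
`E_i(principalPart (S - 1) w_p) ≤ n² Σₖₗ [(1+ε) η² E_i(∂ₖ∂ₗw_p) + C_sh Mc² E_i(∂ₗw_p)]`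
(the lower part one order down, `E_{i-1}(∂ₖ∂ₗw) ≤ E_i(∂ₗw)`). [cite: Evans2010, §7.1.3] -/
theorem sobolevEnergy_top_le (p : ι) (i : ℕ) {ε : ℝ} (hε : 0 < ε) (hε1 : ε ≤ 1) :
    ∃ Csh : ℝ≥0∞, Csh ≠ ⊤ ∧ ∀ {f : M → F'} {Ss : E' → (E' →L[ℝ] E')} {η Mc : ℝ},
      ContDiffOn ℝ ∞ (f ∘ (P.chart p).inv) (P.chart p).target →
      (∀ k l, ContDiff ℝ ∞ (topCoeff P p Ss k l)) →
      (∀ k l y, |topCoeff P p Ss k l y| ≤ η) →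
      (∀ k l, ∀ lst : List (Fin (Module.finrank ℝ E')), lst ≠ [] → lst.length ≤ i →
        ∀ y, ‖iterDirDeriv (lst.map (stdOrthonormalBasis ℝ E')) (topCoeff P p Ss k l) y‖ ≤ Mc) →
      sobolevEnergy i (fun y ↦ principalPart (Ss y - 1) (cutExpr P p f) y) ≤
        ((Module.finrank ℝ E' * Module.finrank ℝ E' : ℕ) : ℝ≥0∞) * ∑ k, ∑ l,
          (ENNReal.ofReal (1 + ε) * ENNReal.ofReal (η ^ 2) *
              sobolevEnergy i (fun y ↦ fderiv ℝ (fun z ↦ fderiv ℝ (cutExpr P p f) z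
                (stdOrthonormalBasis ℝ E' l)) y (stdOrthonormalBasis ℝ E' k)) +
            Csh * ENNReal.ofReal (Mc ^ 2) *
              sobolevEnergy i (fun y ↦ fderiv ℝ (cutExpr P p f) y (stdOrthonormalBasis ℝ E' l))) := by
  classical
  set b := stdOrthonormalBasis ℝ E'
  cases i with
  | zero =>
    refine ⟨0, ENNReal.zero_ne_top, ?_⟩
    intro f Ss η Mc hf ha haη _
    have hw : ContDiff ℝ ∞ (cutExpr P p f) := contDiff_cutExpr P hf
    have hd1 : ∀ v, ContDiff ℝ ∞ fun y ↦ fderiv ℝ (cutExpr P p f) y v := fun v ↦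
      (hw.fderiv_right (m := ∞) (by norm_cast)).clm_apply contDiff_const
    have hdd : ∀ k l, ContDiff ℝ ∞ fun y ↦ fderiv ℝ (fun z ↦ fderiv ℝ (cutExpr P p f) z (b l)) y (b k) :=
      fun k l ↦ ((hd1 (b l)).fderiv_right (m := ∞) (by norm_cast)).clm_apply contDiff_const
    have heq : (fun y ↦ principalPart (Ss y - 1) (cutExpr P p f) y) = fun y ↦ ∑ kl : Fin _ × Fin _,
        topCoeff P p Ss kl.1 kl.2 y • fderiv ℝ (fun z ↦ fderiv ℝ (cutExpr P p f) z (b kl.2)) y (b kl.1) := by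
      funext y; rw [principalPart_sub_one_eq_sum_topCoeff, Fintype.sum_prod_type]
    rw [heq]
    calc sobolevEnergy 0 (fun y ↦ ∑ kl : Fin _ × Fin _, topCoeff P p Ss kl.1 kl.2 y •
          fderiv ℝ (fun z ↦ fderiv ℝ (cutExpr P p f) z (b kl.2)) y (b kl.1))
        ≤ (Finset.univ.card : ℝ≥0∞) * ∑ kl : Fin _ × Fin _, sobolevEnergy 0
            (fun y ↦ topCoeff P p Ss kl.1 kl.2 y •
              fderiv ℝ (fun z ↦ fderiv ℝ (cutExpr P p f) z (b kl.2)) y (b kl.1)) :=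
          sobolevEnergy_sum_le_card 0 Finset.univ fun kl _ ↦
            ((ha kl.1 kl.2).smul (hdd kl.1 kl.2)).of_le (by exact_mod_cast le_top)
      _ ≤ ((Module.finrank ℝ E' * Module.finrank ℝ E' : ℕ) : ℝ≥0∞) * ∑ kl : Fin _ × Fin _,
            ENNReal.ofReal (η ^ 2) * sobolevEnergy 0
              (fun y ↦ fderiv ℝ (fun z ↦ fderiv ℝ (cutExpr P p f) z (b kl.2)) y (b kl.1)) := by
          refine mul_le_mul' (le_of_eq ?_) (Finset.sum_le_sum fun kl _ ↦ ?_)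
          · rw [Finset.card_univ, Fintype.card_prod, Fintype.card_fin]
          · exact sobolevEnergy_smul_le_zero (haη kl.1 kl.2) _
      _ ≤ _ := by
          rw [Fintype.sum_prod_type]
          refine mul_le_mul' le_rfl (Finset.sum_le_sum fun k _ ↦ Finset.sum_le_sum fun l _ ↦ ?_)
          calc ENNReal.ofReal (η ^ 2) * sobolevEnergy 0
                (fun y ↦ fderiv ℝ (fun z ↦ fderiv ℝ (cutExpr P p f) z (b l)) y (b k))
              ≤ ENNReal.ofReal (1 + ε) * ENNReal.ofReal (η ^ 2) * sobolevEnergy 0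
                (fun y ↦ fderiv ℝ (fun z ↦ fderiv ℝ (cutExpr P p f) z (b l)) y (b k)) := by
                rw [mul_assoc]
                refine le_mul_of_one_le_left bot_le ?_
                rw [← ENNReal.ofReal_one]
                exact ENNReal.ofReal_le_ofReal (by linarith)
            _ ≤ _ := le_self_add
  | succ k =>
    obtain ⟨C, hCtop, hC⟩ := sobolevEnergy_sum_smul_le_sharp (E := E') (F := F') k hε hε1
    refine ⟨C, hCtop, ?_⟩
    intro f Ss η Mc hf ha haη haw
    have hw : ContDiff ℝ ∞ (cutExpr P p f) := contDiff_cutExpr P hf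
    have hd1 : ∀ v, ContDiff ℝ ∞ fun y ↦ fderiv ℝ (cutExpr P p f) y v := fun v ↦
      (hw.fderiv_right (m := ∞) (by norm_cast)).clm_apply contDiff_const
    have hdd : ∀ k l, ContDiff ℝ ∞ fun y ↦ fderiv ℝ (fun z ↦ fderiv ℝ (cutExpr P p f) z (b l)) y (b k) :=
      fun k l ↦ ((hd1 (b l)).fderiv_right (m := ∞) (by norm_cast)).clm_apply contDiff_const
    have heq : (fun y ↦ principalPart (Ss y - 1) (cutExpr P p f) y) = fun y ↦ ∑ kl : Fin _ × Fin _,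
        topCoeff P p Ss kl.1 kl.2 y • fderiv ℝ (fun z ↦ fderiv ℝ (cutExpr P p f) z (b kl.2)) y (b kl.1) := by
      funext y; rw [principalPart_sub_one_eq_sum_topCoeff, Fintype.sum_prod_type]
    rw [heq]
    have h := hC Finset.univ (m := fun kl : Fin _ × Fin _ ↦ topCoeff P p Ss kl.1 kl.2)
      (g := fun kl y ↦ fderiv ℝ (fun z ↦ fderiv ℝ (cutExpr P p f) z (b kl.2)) y (b kl.1))
      (fun kl _ ↦ ha kl.1 kl.2) (fun kl _ ↦ hdd kl.1 kl.2) (M₀ := η) (M := Mc)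
      (fun kl _ y ↦ haη kl.1 kl.2 y) (fun kl _ lst hl hlen y ↦ haw kl.1 kl.2 lst hl hlen y)
    refine h.trans ?_
    rw [Finset.card_univ, Fintype.card_prod, Fintype.card_fin, Fintype.sum_prod_type]
    refine mul_le_mul' le_rfl (Finset.sum_le_sum fun k' _ ↦ Finset.sum_le_sum fun l _ ↦
      add_le_add le_rfl (mul_le_mul' le_rfl ?_))
    -- `E_k(∂ₖ'∂ₗ w) ≤ E_{k+1}(∂ₗ w)`
    rw [sobolevEnergy_succ]
    refine le_trans ?_ le_add_self
    exact Finset.single_le_sum (f := fun j ↦ sobolevEnergy k fun y ↦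
      fderiv ℝ (fun z ↦ fderiv ℝ (cutExpr P p f) z (b l)) y (b j)) (fun _ _ ↦ bot_le) (Finset.mem_univ k')

variable [IsManifold I ∞ M] [T2Space M]

/-- **The energy of the heat residual of a cut-off chart expression**: top order with the sharp
constant and the small factor `η²`, lower order through all patches. For `ε ∈ (0, 1]` and every
`i` there are `C_sh, C_low, C_g < ∞` (depending on the patch system, `p`, `i`, `ε` only) such
that for all data as in `sobolevEnergy_low_le`, `sobolevEnergy_top_le`, with `uₜ` smooth on the
target and satisfying the chart form of the system there,
`E_i(cut • uₜ - Δw_p) ≤ (1+ε) n² Σₖₗ [(1+ε)η² E_i(∂ₖ∂ₗw_p) + C_sh Mc² E_i(∂ₗw_p)]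
  + (1+ε⁻¹) [C_low (Mc²+1) Σ_q (E_i(w_q) + Σ_m E_i(∂_m w_q)) + C_g E_i(cutExpr P p g)]`
(`uₜ` enters through the smooth product `cut • uₜ` and its values on the target).
[cite: Evans2010, §7.1.3] -/
theorem sobolevEnergy_residual_le (p : ι) (i : ℕ) {ε : ℝ} (hε : 0 < ε) (hε1 : ε ≤ 1) :
    ∃ Csh Clow Cg : ℝ≥0∞, Csh ≠ ⊤ ∧ Clow ≠ ⊤ ∧ Cg ≠ ⊤ ∧
      ∀ {f g : M → F'} {uₜ : E' → F'} {Ss : E' → (E' →L[ℝ] E')}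
        {𝔟s : E' → ((E' →L[ℝ] F') →L[ℝ] F')} {𝔠s : E' → (F' →L[ℝ] F')} {η Mc : ℝ},
      (∀ q, ContDiffOn ℝ ∞ (f ∘ (P.chart q).inv) (P.chart q).target) →
      ContDiffOn ℝ ∞ (g ∘ (P.chart p).inv) (P.chart p).target →
      (ContDiff ℝ ∞ fun y ↦ P.cut p y • uₜ y) →
      (∀ y ∈ (P.chart p).target, uₜ y = frameOp (Ss y) (𝔟s y) (𝔠s y) (f ∘ (P.chart p).inv) y +
        g ((P.chart p).inv y)) →
      (∀ k l, ContDiff ℝ ∞ (topCoeff P p Ss k l)) → (∀ l, ContDiff ℝ ∞ (firstCoeff P p 𝔟s l)) →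
      ContDiff ℝ ∞ (zeroCoeff P p 𝔠s) →
      (∀ k l y, |topCoeff P p Ss k l y| ≤ η) →
      (∀ k l y, |topCoeff P p Ss k l y| ≤ Mc) →
      (∀ k l, ∀ lst : List (Fin (Module.finrank ℝ E')), lst ≠ [] → lst.length ≤ i →
        ∀ y, ‖iterDirDeriv (lst.map (stdOrthonormalBasis ℝ E')) (topCoeff P p Ss k l) y‖ ≤ Mc) →
      (∀ l y, ‖firstCoeff P p 𝔟s l y‖ ≤ Mc) →
      (∀ l, ∀ lst : List (Fin (Module.finrank ℝ E')), lst ≠ [] → lst.length ≤ i →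
        ∀ y, ‖iterDirDeriv (lst.map (stdOrthonormalBasis ℝ E')) (firstCoeff P p 𝔟s l) y‖ ≤ Mc) →
      (∀ y, ‖zeroCoeff P p 𝔠s y‖ ≤ Mc) →
      (∀ lst : List (Fin (Module.finrank ℝ E')), lst ≠ [] → lst.length ≤ i →
        ∀ y, ‖iterDirDeriv (lst.map (stdOrthonormalBasis ℝ E')) (zeroCoeff P p 𝔠s) y‖ ≤ Mc) →
      sobolevEnergy i (fun y ↦ P.cut p y • uₜ y - (Δ (cutExpr P p f)) y) ≤
        ENNReal.ofReal (1 + ε) * (((Module.finrank ℝ E' * Module.finrank ℝ E' : ℕ) : ℝ≥0∞) * ∑ k, ∑ l,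
          (ENNReal.ofReal (1 + ε) * ENNReal.ofReal (η ^ 2) *
              sobolevEnergy i (fun y ↦ fderiv ℝ (fun z ↦ fderiv ℝ (cutExpr P p f) z
                (stdOrthonormalBasis ℝ E' l)) y (stdOrthonormalBasis ℝ E' k)) +
            Csh * ENNReal.ofReal (Mc ^ 2) *
              sobolevEnergy i (fun y ↦ fderiv ℝ (cutExpr P p f) y (stdOrthonormalBasis ℝ E' l)))) +
        ENNReal.ofReal (1 + ε⁻¹) * (Clow * ENNReal.ofReal (Mc ^ 2 + 1) *
            ∑ q, (sobolevEnergy i (cutExpr P q f) +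
              ∑ m, sobolevEnergy i (fun y ↦ fderiv ℝ (cutExpr P q f) y (stdOrthonormalBasis ℝ E' m))) +
          Cg * sobolevEnergy i (cutExpr P p g)) := by
  obtain ⟨Csh, hCshtop, hCsh⟩ := sobolevEnergy_top_le (F' := F') P p i hε hε1
  obtain ⟨Clow, Cg, hClowtop, hCgtop, hClow⟩ := sobolevEnergy_low_le (F' := F') P p i
  refine ⟨Csh, Clow, Cg, hCshtop, hClowtop, hCgtop, ?_⟩
  intro f g uₜ Ss 𝔟s 𝔠s η Mc hf hg huₜ hpde ha hBf hCf haη ha0 haw hB0 hBw hC0 hCw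
  set b := stdOrthonormalBasis ℝ E'
  have hV := (P.chart p).isOpen_target
  have hcs : ContDiff ℝ ∞ (P.cut p) := (P.cut p).contDiff
  have hct : tsupport (P.cut p) ⊆ (P.chart p).target := P.tsupport_cut_subset p
  have hw : ContDiff ℝ ∞ (cutExpr P p f) := contDiff_cutExpr P (hf p)
  -- as functions: `RES = TOP + LOW` (the pointwise identity on the target; off it all vanishes)
  obtain ⟨TOP, hTOP⟩ : ∃ TOP : E' → F', TOP = fun y ↦ principalPart (Ss y - 1) (cutExpr P p f) y := ⟨_, rfl⟩
  obtain ⟨LOW, hLOW⟩ : ∃ LOW : E' → F', LOW = fun y ↦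
      -lowerSymbol (Ss y - 1) (P.cut p) (f ∘ (P.chart p).inv) y +
      P.cut p y • (𝔟s y (fderiv ℝ (f ∘ (P.chart p).inv) y) + 𝔠s y ((f ∘ (P.chart p).inv) y) +
        g ((P.chart p).inv y)) -
      (2 • ∑ l, fderiv ℝ (P.cut p) y (b l) • fderiv ℝ (f ∘ (P.chart p).inv) y (b l)) -
      (Δ (⇑(P.cut p))) y • (f ∘ (P.chart p).inv) y := ⟨_, rfl⟩
  have hRES : (fun y ↦ P.cut p y • uₜ y - (Δ (cutExpr P p f)) y) = fun y ↦ TOP y + LOW y := by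
    funext y
    rw [hTOP, hLOW, cutExpr_eq_smul]
    simp only
    have hfun : (fun y ↦ P.cut p y • f ((P.chart p).inv y)) =
        fun z ↦ P.cut p z • (f ∘ (P.chart p).inv) z := rfl
    rw [hfun]
    by_cases hy : y ∈ (P.chart p).target
    · rw [cut_smul_sub_laplacian_smul_eq hV hcs hct (hf p) Ss (𝔟s y) (𝔠s y)
        (fun y ↦ g ((P.chart p).inv y)) (hpde y hy)]
      abel
    · -- off the target: every term vanishes
      have hy' : y ∉ tsupport (P.cut p) := fun h ↦ hy (hct h)
      obtain ⟨h0, h1⟩ := eq_zero_of_notMem_tsupport (P.cut p) hy'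
      have hP : principalPart (Ss y - 1) (fun z ↦ P.cut p z • (f ∘ (P.chart p).inv) z) y = 0 := by
        rw [← hfun, ← cutExpr_eq_smul, principalPart_sub_one_eq_sum_topCoeff]
        refine Finset.sum_eq_zero fun k _ ↦ Finset.sum_eq_zero fun l _ ↦ ?_
        rw [fderiv_fderiv_cutExpr_eq_zero P p f hy']
        simp
      have hΔw : (Δ (fun z ↦ P.cut p z • (f ∘ (P.chart p).inv) z)) y = 0 := by
        have hev : (fun z ↦ P.cut p z • f ((P.chart p).inv z)) =ᶠ[𝓝 y] fun _ ↦ 0 := by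
          have hc : (P.cut p : E' → ℝ) =ᶠ[𝓝 y] fun _ ↦ 0 := notMem_tsupport_iff_eventuallyEq.1 hy'
          filter_upwards [hc] with z hz
          simp [hz]
        have h2 : iteratedFDeriv ℝ 2 (fun z ↦ P.cut p z • f ((P.chart p).inv z)) y = 0 := by
          rw [(hev.iteratedFDeriv ℝ 2).self_of_nhds, iteratedFDeriv_const_of_ne two_ne_zero]
          rfl
        show (Δ (fun z ↦ P.cut p z • f ((P.chart p).inv z))) y = 0
        rw [laplacian_eq_iteratedFDeriv_stdOrthonormalBasis]
        simp [h2]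
      rw [hP, hΔw, lowerSymbol_eq_zero _ _ hy', h0, h1, laplacian_cut_eq_zero P p hy']
      simp
  -- smoothness of `RES` and `TOP`, hence of `LOW`
  have hRESs : ContDiff ℝ ∞ fun y ↦ P.cut p y • uₜ y - (Δ (cutExpr P p f)) y :=
    huₜ.sub (contDiff_laplacian_of_contDiff hw)
  have hTOPs : ContDiff ℝ ∞ TOP := by
    rw [hTOP]
    have heq : (fun y ↦ principalPart (Ss y - 1) (cutExpr P p f) y) = fun y ↦ ∑ k, ∑ l,
        topCoeff P p Ss k l y • fderiv ℝ (fun z ↦ fderiv ℝ (cutExpr P p f) z (b l)) y (b k) :=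
      funext fun y ↦ principalPart_sub_one_eq_sum_topCoeff P p Ss f y
    rw [heq]
    have hd1 : ∀ v, ContDiff ℝ ∞ fun y ↦ fderiv ℝ (cutExpr P p f) y v := fun v ↦
      (hw.fderiv_right (m := ∞) (by norm_cast)).clm_apply contDiff_const
    exact ContDiff.sum fun k _ ↦ ContDiff.sum fun l _ ↦ (ha k l).smul
      (((hd1 (b l)).fderiv_right (m := ∞) (by norm_cast)).clm_apply contDiff_const)
  have hLOWs : ContDiff ℝ ∞ LOW := by
    have h : LOW = fun y ↦ (P.cut p y • uₜ y - (Δ (cutExpr P p f)) y) - TOP y := by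
      funext y
      have hy : P.cut p y • uₜ y - (Δ (cutExpr P p f)) y = TOP y + LOW y := congr_fun hRES y
      rw [hy]
      abel
    rw [h]
    exact hRESs.sub hTOPs
  -- combine
  rw [hRES]
  refine (sobolevEnergy_add_le_eps i (hTOPs.of_le (by exact_mod_cast le_top))
    (hLOWs.of_le (by exact_mod_cast le_top)) hε).trans ?_
  refine add_le_add (mul_le_mul' le_rfl ?_) (mul_le_mul' le_rfl ?_)
  · rw [hTOP]
    exact hCsh (hf p) ha haη haw
  · rw [hLOW]
    exact hClow hf hg ha hBf hCf ha0 haw hB0 hBw hC0 hCw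

end Top

end PatchSystemLoc

end Literature.Analysis.PDE

end
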